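import Literature.GroupTheory.SL25SubgroupClasses
import Literature.NumberTheory.LFunctions.AlmostMonomialLowDegree
import Literature.RepresentationTheory.FiniteGroups.ProductGroupCharacters
import Mathlib.NumberTheory.Zsqrtd.GaussianInt
import HarnessLib

/-!
# Booker's counterexample `SL₂(𝔽₅)`, I: the characters `χ₆` (principal series) and `χ₄`

Topic `Literature/NumberTheory/LFunctions`; namespace `Literature.NumberTheory.LFunctions`, grouping
namespace `Booker2006.SL25`.  First half of the discharge of the `SL₂(𝔽₅)` clause of the named fact
`booker2006_notAlmostMonomial` (`CertifiedArtinHolomorphyCriterion.lean`, Booker, Exp. Math. 15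
(2006) §2 p. 390: "one might hope that all groups are almost monomial. That is not the case, as the
counterexamples `GL₂(𝔽₃)` and `SL₂(𝔽₅)` show … for `ρ` the 6-dimensional representation, (2–4) fails
with `χ₁` corresponding to any of the vectors `(0,−1,0,0,0,0,0,0,1)`, `(0,0,−1,0,0,0,0,0,1)`, and
`(0,0,0,0,0,0,−1,0,1)`, i.e., the representations of dimension 2 and one of dimension 4 can hide a
pole at a zero of `L(s, ρ)`" — a GAP computation).  We use the third vector: `Tr ρ = χ₆`,
`χ₂ = χ₄` the FAITHFUL irreducible character of degree 4, `χ₁ = χ₆ − χ₄`.  All three are integer valued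
and depend only on the order of the element (read off the trace):

| order        | 1 | 2  | 3  | 4 | 5  | 6  | 10 |
|--------------|---|----|----|---|----|----|----|
| `χ₆`         | 6 | −6 | 0  | 0 | 1  | 0  | −1 |
| `χ₄`         | 4 | −4 | 1  | 0 | −1 | −1 | 1  |
| `χ₁ = χ₆−χ₄` | 2 | −2 | −1 | 0 | 2  | 1  | −2 |

This file PROVES (kernel computations by `decide`, block-wise over `SL25.elems`):
* `χ₆ = Ind_B^G ψ` for the Borel subgroup `B` (upper triangular, order 20) and the faithful character
  `ψ : (t * ; 0 t⁻¹) ↦ i^{log₂ t}` of `B/U ≅ 𝔽₅ˣ` (Gaussian-integer valued), `⟨χ₆, χ₆⟩ = 1`: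
  **`χ₆` is an irreducible character** (`isIrrChar_chi6`; the principal series of `SL(2,5)`);
* `Ind_N^G θ = χ₄ + χ₆` for `N = N_G(C₆)` (dicyclic of order 12, the listing `SL25.K12`) and its
  linear character `θ` of order 4 (`aʲ ↦ (−1)ʲ`, `aʲx ↦ (−1)ʲ i`); so `χ₄ ∈ R(G)`, `⟨χ₄, χ₄⟩ = 1`,
  `χ₄(1) = 4 > 0`, whence **`χ₄` is an irreducible character** (`isIrrChar_chi4`, via the general
  `isIrrChar_of_mem_virtChars_of_classInner_eq_one`: a virtual character of norm 1 and positive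
  degree is irreducible, Serre §9.1 / Isaacs 2.8 style).
The DM-positivity of `χ₁` and the conclusion `¬ IsAlmostMonomial SL(2,5)` are in
`NotAlmostMonomialSL25.lean`.  No definition of a new notion, no named fact.

## References
* [Booker2006] A. R. Booker, *Artin's conjecture, Turing's method, and the Riemann hypothesis*,
  Experiment. Math. 15 (2006) 385–407, §2 Definition 2.1 (p. 389), pp. 390–391 (journal pdf
  `paper:url-702ab4eacdaa` pp. 6–7; arXiv math/0507502 pp. 7–9).
* [JamesLiebeck2001] G. James, M. Liebeck, *Representations and Characters of Groups*, 2nd ed.,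
  CUP 2001, Ch. 28 (Borel subgroup, principal series `λ↑G`), Thm. 14.20.
* [SerreLinearRepresentations1977] J.-P. Serre, *Linear Representations of Finite Groups*, §7.2
  (`Ind`), §9.1 (`R(G)`), §2.3 Thm. 3.
-/

noncomputable section

open scoped ComplexOrder MatrixGroups
open Finset

namespace Literature.NumberTheory.LFunctions

namespace Booker2006

open Literature.RepresentationTheory.FiniteGroups

section General

variable {G : Type} [Group G] [Fintype G]

/-- **A virtual character of norm `1` and positive degree is an irreducible character**
(`f = Σ a_χ χ` with `Σ a_χ² = 1` forces `f = ±χ₀`, and `f(1) > 0` picks the sign; Serre §9.1 with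
§2.3 Thm. 3). [cite: SerreLinearRepresentations1977, §9.1] -/
theorem isIrrChar_of_mem_virtChars_of_classInner_eq_one {f : G → ℂ} (hf : f ∈ virtChars G)
    (h1 : classInner f f = 1) {d : ℕ} (hd : f 1 = d) (hdpos : 0 < d) : IsIrrChar G f := by
  classical
  have hcl : IsClassFun f := isClassFun_of_mem_virtChars hf
  set F := (irrChars_finite_holds G).toFinset with hF
  have hint : ∀ ψ ∈ F, ∃ a : ℤ, classInner f ψ = a := fun ψ hψ =>
    exists_int_classInner_of_mem_virtChars hf ((irrChars_finite_holds G).mem_toFinset.mp hψ)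
  choose! a ha using hint
  have hpar : classInner f f = ((∑ ψ ∈ F, a ψ * a ψ : ℤ) : ℂ) := by
    rw [classInner_self_eq_sum_sq hcl, Int.cast_sum]
    exact Finset.sum_congr rfl fun ψ hψ => by rw [ha ψ hψ, Int.cast_mul]
  have hone : ∑ ψ ∈ F, a ψ * a ψ = 1 := by
    have : ((∑ ψ ∈ F, a ψ * a ψ : ℤ) : ℂ) = ((1 : ℤ) : ℂ) := by rw [← hpar, h1, Int.cast_one]
    exact_mod_cast this
  -- one coefficient is `±1`, the others vanish
  obtain ⟨ψ₀, hψ₀F, hne⟩ : ∃ ψ₀ ∈ F, a ψ₀ ≠ 0 := by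
    by_contra hcon
    push Not at hcon
    have : ∑ ψ ∈ F, a ψ * a ψ = 0 := Finset.sum_eq_zero fun ψ hψ => by rw [hcon ψ hψ, mul_zero]
    omega
  have hrest : ∑ ψ ∈ F.erase ψ₀, a ψ * a ψ = 1 - a ψ₀ * a ψ₀ := by
    rw [← hone, ← Finset.add_sum_erase F _ hψ₀F]; ring
  have hnn : ∀ ψ ∈ F.erase ψ₀, 0 ≤ a ψ * a ψ := fun ψ _ => mul_self_nonneg _
  have hsq1 : 1 ≤ a ψ₀ * a ψ₀ := by
    rcases lt_or_gt_of_ne hne with h' | h' <;> nlinarith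
  have hsq : a ψ₀ * a ψ₀ = 1 := by
    have := Finset.sum_nonneg hnn; omega
  have hothers : ∀ ψ ∈ F, ψ ≠ ψ₀ → a ψ = 0 := by
    intro ψ hψ hne'
    have h0 : ∑ ψ ∈ F.erase ψ₀, a ψ * a ψ = 0 := by omega
    exact mul_self_eq_zero.mp
      ((Finset.sum_eq_zero_iff_of_nonneg hnn).mp h0 ψ (Finset.mem_erase.mpr ⟨hne', hψ⟩))
  have hψ₀ : IsIrrChar G ψ₀ := (irrChars_finite_holds G).mem_toFinset.mp hψ₀F
  have hfeq : f = (a ψ₀ : ℂ) • ψ₀ := by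
    rw [hcl.eq_sum_classInner_smul, ← Finset.add_sum_erase F _ hψ₀F, ha ψ₀ hψ₀F]
    have : ∑ ψ ∈ F.erase ψ₀, classInner f ψ • ψ = 0 :=
      Finset.sum_eq_zero fun ψ hψ => by
        obtain ⟨hne', hmem⟩ := Finset.mem_erase.mp hψ
        rw [ha ψ hmem, hothers ψ hmem hne', Int.cast_zero, zero_smul]
    rw [this, add_zero]
  -- the sign from `f(1) = d > 0` and `ψ₀(1) > 0`
  obtain ⟨d₀, hd₀, hd₀1⟩ := hψ₀.exists_apply_one
  have hd₀pos : 0 < d₀ := pos_of_mem_charDegrees hd₀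
  have hprod : (a ψ₀ : ℂ) * d₀ = d := by
    have := congrFun hfeq 1
    rw [Pi.smul_apply, smul_eq_mul, hd₀1, hd] at this
    exact this.symm
  have hprod' : a ψ₀ * (d₀ : ℤ) = d := by exact_mod_cast hprod
  have ha1 : a ψ₀ = 1 := by
    have hapos : 0 < a ψ₀ := by
      by_contra hle
      push Not at hle
      have : a ψ₀ * (d₀ : ℤ) ≤ 0 := mul_nonpos_of_nonpos_of_nonneg hle (by positivity)
      omega
    nlinarith
  rw [hfeq, ha1, Int.cast_one, one_smul]
  exact hψ₀

/-- **Characters are DM-positive**: `⟨φ, Ind_H^G λ⟩ ∈ ℕ` for a character `φ` (the scalar product of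
two characters). [cite: Booker2006, §2 (2–4) p. 389] -/
theorem _root_.Literature.RepresentationTheory.FiniteGroups.IsCharacter.isDMPositive {φ : G → ℂ}
    (hφ : IsCharacter G φ) : IsDMPositive φ := by
  intro H θ
  obtain ⟨n, hn⟩ := hφ.classInner_natCast ((isCharacter_coe_monoidHom' θ).indClassFun H)
  rw [hn]
  exact_mod_cast Nat.zero_le n

end General

namespace SL25

open Literature.GroupTheory Literature.GroupTheory.SL25

/-! ### The class functions `χ₆`, `χ₄`, `χ₁` by element order (via the trace) -/

/-- The trace of `g ∈ SL(2,5)`. [folklore] -/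
def tr (g : SL(2, ZMod 5)) : ZMod 5 := g.1 0 0 + g.1 1 1

/-- `−1 ∈ SL(2,5)`. [folklore] -/
def z : SL(2, ZMod 5) := m 4 0 0 4

/-- The values of `χ₆` (`±6` at `±1`; trace `2` (order 5): `1`; trace `3` (order 10): `−1`; else
`0`). [cite: Booker2006, §2 pp. 390–391] -/
def T6 (g : SL(2, ZMod 5)) : ℤ :=
  if g = 1 then 6 else if g = z then -6 else if tr g = 2 then 1 else if tr g = 3 then -1 else 0

/-- The values of `χ₄` (`±4` at `±1`; trace `4` (order 3): `1`; trace `1` (order 6): `−1`; trace `2`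
(order 5): `−1`; trace `3` (order 10): `1`; trace `0` (order 4): `0`).
[cite: Booker2006, §2 pp. 390–391] -/
def T4 (g : SL(2, ZMod 5)) : ℤ :=
  if g = 1 then 4 else if g = z then -4 else if tr g = 4 then 1 else if tr g = 1 then -1
  else if tr g = 2 then -1 else if tr g = 3 then 1 else 0

/-- `χ₁ = χ₆ − χ₄` as an integer table. [cite: Booker2006, §2 p. 391] -/
def T1 (g : SL(2, ZMod 5)) : ℤ := T6 g - T4 g

/-- `χ₆ : SL(2,5) → ℂ` (degree `6`). [cite: Booker2006, §2 pp. 390–391] -/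
def chi6 (g : SL(2, ZMod 5)) : ℂ := (T6 g : ℂ)

/-- `χ₄ : SL(2,5) → ℂ` (the faithful irreducible character of degree `4`).
[cite: Booker2006, §2 pp. 390–391] -/
def chi4 (g : SL(2, ZMod 5)) : ℂ := (T4 g : ℂ)

/-- `χ₁ = χ₆ − χ₄ : SL(2,5) → ℂ` (Booker's vector `(0,0,0,0,0,0,−1,0,1)`). [cite: Booker2006, §2 p. 391] -/
def chi1 (g : SL(2, ZMod 5)) : ℂ := (T1 g : ℂ)

/-- `χ₁ = χ₆ − χ₄`. [cite: Booker2006, §2 p. 391] -/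
theorem chi1_eq : chi1 = chi6 - chi4 := by
  funext g; simp [chi1, chi6, chi4, T1]

/-- `χ₆ = χ₁ + χ₄`. [cite: Booker2006, §2 p. 391] -/
theorem chi6_eq_add : chi6 = chi1 + chi4 := by
  rw [chi1_eq]; abel

/-- `χ₄(1) = 4`. [cite: Booker2006, §2 pp. 390–391] -/
theorem chi4_one : chi4 1 = ((4 : ℕ) : ℂ) := by
  have : T4 1 = 4 := by decide
  simp [chi4, this]

/-- `χ₆(1) = 6`. [cite: Booker2006, §2 pp. 390–391] -/
theorem chi6_one : chi6 1 = ((6 : ℕ) : ℂ) := by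
  have : T6 1 = 6 := by decide
  simp [chi6, this]

/-- `χ₁(1) = 2`. [cite: Booker2006, §2 p. 391] -/
theorem chi1_one : chi1 1 = 2 := by
  have : T1 1 = 2 := by decide
  simp [chi1, this]

/-- `|SL(2,5)| = 120`. [folklore] -/
private theorem card_G : Fintype.card SL(2, ZMod 5) = 120 := by decide +kernel

/-- A scalar product of integer-table class functions, reduced to an integer sum. [folklore] -/
private theorem classInner_eq_of_sum (F F' : SL(2, ZMod 5) → ℤ) (k : ℤ)
    (hsum : ∑ g : SL(2, ZMod 5), F g * F' g⁻¹ = 120 * k) :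
    classInner (fun g => (F g : ℂ)) (fun g => (F' g : ℂ)) = (k : ℂ) := by
  rw [classInner_apply, card_G]
  have h : ∑ g : SL(2, ZMod 5), (F g : ℂ) * (F' g⁻¹ : ℂ) =
      ((∑ g : SL(2, ZMod 5), F g * F' g⁻¹ : ℤ) : ℂ) := by
    push_cast; rfl
  rw [h, hsum]; push_cast; ring

/-- `Σ_g χ₆(g)χ₆(g⁻¹) = 120` (kernel check). [folklore] -/
private theorem sum_T6_T6 : ∑ g : SL(2, ZMod 5), T6 g * T6 g⁻¹ = 120 * 1 := by decide +kernel
/-- `Σ_g χ₄(g)χ₄(g⁻¹) = 120` (kernel check). [folklore] -/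
private theorem sum_T4_T4 : ∑ g : SL(2, ZMod 5), T4 g * T4 g⁻¹ = 120 * 1 := by decide +kernel

/-- `⟨χ₆, χ₆⟩ = 1`. [cite: Booker2006, §2 pp. 390–391] -/
theorem classInner_chi6 : classInner chi6 chi6 = 1 := by
  have := classInner_eq_of_sum T6 T6 1 sum_T6_T6
  rw [Int.cast_one] at this
  exact this

/-- `⟨χ₄, χ₄⟩ = 1`. [cite: Booker2006, §2 pp. 390–391] -/
theorem classInner_chi4 : classInner chi4 chi4 = 1 := by
  have := classInner_eq_of_sum T4 T4 1 sum_T4_T4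
  rw [Int.cast_one] at this
  exact this

/-! ### Induced Gaussian-integer-valued linear characters, block-wise -/

/-- The defining sum of an induced class function for a `ℤ[i]`-valued function `f` supported on a
subset `S` (Boolean test `inS`): `Σ_t [t⁻¹st ∈ S] f(t⁻¹st)`. [cite: SerreLinearRepresentations1977, §7.2] -/
def indSum (inS : SL(2, ZMod 5) → Bool) (f : SL(2, ZMod 5) → GaussianInt) (s : SL(2, ZMod 5)) :
    GaussianInt :=
  ∑ t : SL(2, ZMod 5), if inS (t⁻¹ * s * t) = true then f (t⁻¹ * s * t) else 0

/-- From a `ℤ[i]ˣ`-valued homomorphism on a subgroup with Boolean membership test to the defining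
sum of the induced character, via `ℤ[i] → ℂ`. [cite: SerreLinearRepresentations1977, §7.2] -/
private theorem indClassFun_eq_of_units (H : Subgroup SL(2, ZMod 5)) (inS : SL(2, ZMod 5) → Bool)
    (hS : ∀ g, g ∈ H ↔ inS g = true) (f : SL(2, ZMod 5) → GaussianInt) (θ : H →* ℂˣ)
    (hθ : ∀ h : H, ((θ h : ℂˣ) : ℂ) = GaussianInt.toComplex (f h)) (s : SL(2, ZMod 5)) :
    indClassFun H (fun h => ((θ h : ℂˣ) : ℂ)) s =
      (Nat.card H : ℂ)⁻¹ * GaussianInt.toComplex (indSum inS f s) := by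
  rw [indClassFun_apply, indSum, map_sum]
  congr 1
  refine Finset.sum_congr rfl fun t _ => ?_
  by_cases h : inS (t⁻¹ * s * t) = true
  · have hmem : t⁻¹ * s * t ∈ H := (hS _).mpr h
    rw [show t⁻¹ * s * t = ((⟨t⁻¹ * s * t, hmem⟩ : H) : SL(2, ZMod 5)) from rfl,
      extend_subtypeVal_apply, hθ, if_pos h]
  · have hnmem : t⁻¹ * s * t ∉ H := fun hm => h ((hS _).mp hm)
    rw [extend_subtypeVal_of_not_mem _ _ hnmem, if_neg h, map_zero]

/-! ### The Borel subgroup `B` and the principal-series character `χ₆ = Ind_B ψ` -/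

/-- Membership in the Borel subgroup (upper triangular matrices). [cite: JamesLiebeck2001, Ch. 28] -/
def inB (g : SL(2, ZMod 5)) : Bool := decide (g.1 1 0 = 0)

/-- `B` is closed under multiplication. [folklore] -/
private theorem inB_mul : ∀ a b : SL(2, ZMod 5), inB a = true → inB b = true → inB (a * b) = true := by
  decide +kernel

/-- `B` is closed under inversion. [folklore] -/
private theorem inB_inv : ∀ a : SL(2, ZMod 5), inB a = true → inB a⁻¹ = true := by decide +kernel

/-- The Borel subgroup `B = {(t s; 0 t⁻¹)}` of `SL(2,5)` (order `20`; dicyclic, the listing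
`SL25.K20` up to order). [cite: JamesLiebeck2001, Ch. 28] -/
def B : Subgroup SL(2, ZMod 5) where
  carrier := {g | inB g = true}
  mul_mem' := fun {a} {b} ha hb => inB_mul a b ha hb
  one_mem' := by decide
  inv_mem' := fun {a} ha => inB_inv a ha

/-- `|B| = 20`. [folklore] -/
private theorem natCard_B : Nat.card B = 20 := by
  have h : Nat.card B = Nat.card {g : SL(2, ZMod 5) // inB g = true} := rfl
  rw [h, Nat.card_eq_fintype_card, Fintype.card_subtype]
  decide +kernel

/-- The Gaussian-integer values of `ψ`: `i^{log₂ g₀₀}` (`1 ↦ 1, 2 ↦ i, 4 ↦ −1, 3 ↦ −i`).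
[cite: JamesLiebeck2001, Ch. 28] -/
def psiZ (g : SL(2, ZMod 5)) : GaussianInt :=
  if g.1 0 0 = 2 then ⟨0, 1⟩ else if g.1 0 0 = 4 then -1 else if g.1 0 0 = 3 then ⟨0, -1⟩ else 1

/-- The inverse values `i^{−log₂ g₀₀}`. [folklore] -/
def psiZi (g : SL(2, ZMod 5)) : GaussianInt :=
  if g.1 0 0 = 2 then ⟨0, -1⟩ else if g.1 0 0 = 4 then -1 else if g.1 0 0 = 3 then ⟨0, 1⟩ else 1

/-- `ψ · ψ⁻¹ = 1` pointwise (kernel check). [folklore] -/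
private theorem psiZ_mul_psiZi : ∀ g : SL(2, ZMod 5), psiZ g * psiZi g = 1 := by decide +kernel
/-- `ψ⁻¹ · ψ = 1` pointwise (kernel check). [folklore] -/
private theorem psiZi_mul_psiZ : ∀ g : SL(2, ZMod 5), psiZi g * psiZ g = 1 := by decide +kernel
/-- `ψ(1) = 1`. [folklore] -/
private theorem psiZ_one : psiZ 1 = 1 := by decide
/-- `ψ` is multiplicative on `B` (kernel check). [folklore] -/
private theorem psiZ_mul : ∀ a b : SL(2, ZMod 5), inB a = true → inB b = true →
    psiZ (a * b) = psiZ a * psiZ b := by decide +kernel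

/-- `ψ` as a homomorphism `B → ℤ[i]ˣ`. [cite: JamesLiebeck2001, Ch. 28] -/
def psiU : B →* GaussianIntˣ where
  toFun h := ⟨psiZ h, psiZi h, psiZ_mul_psiZi h, psiZi_mul_psiZ h⟩
  map_one' := Units.ext psiZ_one
  map_mul' := fun a b => Units.ext (psiZ_mul a b a.2 b.2)

/-- `ψ : B → ℂˣ`, the faithful character of `B/U ≅ 𝔽₅ˣ ≅ C₄`. [cite: JamesLiebeck2001, Ch. 28] -/
def psi : B →* ℂˣ := (Units.map GaussianInt.toComplex.toMonoidHom).comp psiU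

/-- Values of `ψ` in `ℂ`. [folklore] -/
private theorem coe_psi (h : B) : ((psi h : ℂˣ) : ℂ) = GaussianInt.toComplex (psiZ h) := rfl

/-- The block test for `Ind_B ψ = χ₆`: `Σ_t [t⁻¹st ∈ B] ψ(t⁻¹st) = 20·χ₆(s)`. [folklore] -/
def test6 (s : SL(2, ZMod 5)) : Bool := decide (indSum inB psiZ s = ⟨20 * T6 s, 0⟩)

/-- Block `0` of the kernel check of `test6`. [folklore] -/
private theorem test6_b0 : ((elems.drop 0).take 24).all test6 = true := by decide +kernel
/-- Block `1` of the kernel check of `test6`. [folklore] -/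
private theorem test6_b1 : ((elems.drop 24).take 24).all test6 = true := by decide +kernel
/-- Block `2` of the kernel check of `test6`. [folklore] -/
private theorem test6_b2 : ((elems.drop 48).take 24).all test6 = true := by decide +kernel
/-- Block `3` of the kernel check of `test6`. [folklore] -/
private theorem test6_b3 : ((elems.drop 72).take 24).all test6 = true := by decide +kernel
/-- Block `4` of the kernel check of `test6`. [folklore] -/
private theorem test6_b4 : ((elems.drop 96).take 24).all test6 = true := by decide +kernel

/-- **The table of `Ind_B ψ`** (kernel computation): `Σ_t [t⁻¹st ∈ B] ψ(t⁻¹st) = 20·χ₆(s)`.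
[cite: Booker2006, §2 pp. 390–391] -/
theorem indSum_B_psi (s : SL(2, ZMod 5)) : indSum inB psiZ s = ⟨20 * T6 s, 0⟩ :=
  of_decide_eq_true (forall_of_blocks test6 test6_b0 test6_b1 test6_b2 test6_b3 test6_b4 s)

/-- **`χ₆ = Ind_B^{SL(2,5)} ψ`.** [cite: Booker2006, §2 pp. 390–391] -/
theorem indClassFun_B_psi_eq : indClassFun B (fun h => ((psi h : ℂˣ) : ℂ)) = chi6 := by
  funext s
  rw [indClassFun_eq_of_units B inB (fun _ => Iff.rfl) psiZ psi coe_psi s, indSum_B_psi, natCard_B,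
    GaussianInt.toComplex_def', chi6]
  push_cast; ring

/-- `χ₆` is a character of `SL(2,5)`. [cite: Booker2006, §2 pp. 390–391] -/
theorem isCharacter_chi6 : IsCharacter SL(2, ZMod 5) chi6 := by
  rw [← indClassFun_B_psi_eq]; exact (isCharacter_coe_monoidHom' psi).indClassFun B

/-- **`χ₆` is an irreducible character of `SL(2,5)`** (the principal series of degree `q + 1 = 6`).
[cite: Booker2006, §2 pp. 390–391] -/
theorem isIrrChar_chi6 : IsIrrChar SL(2, ZMod 5) chi6 :=
  isCharacter_chi6.isIrrChar_of_classInner_eq_one classInner_chi6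

/-! ### `N = N_G(C₆)` (the listing `K12`), its order-4 character `θ`, and `Ind_N θ = χ₄ + χ₆` -/

/-- Boolean membership test for `N` (the listing `SL25.K12 = [aʲ] ++ [aʲx]`, `a = (0 1; 4 1)` of
order `6`, `x = (0 2; 2 0)`). [cite: Booker2006, §2 pp. 390–391] -/
def inN (g : SL(2, ZMod 5)) : Bool := decide (g ∈ K12)

/-- `N` is closed under multiplication. [folklore] -/
private theorem inN_mul : ∀ a b : SL(2, ZMod 5), inN a = true → inN b = true → inN (a * b) = true := by
  decide +kernel

/-- `N` is closed under inversion. [folklore] -/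
private theorem inN_inv : ∀ a : SL(2, ZMod 5), inN a = true → inN a⁻¹ = true := by decide +kernel

/-- The dicyclic subgroup `N = N_G(C₆)` of order `12` (element set `SL25.K12`).
[cite: Booker2006, §2 pp. 390–391] -/
def N : Subgroup SL(2, ZMod 5) where
  carrier := {g | inN g = true}
  mul_mem' := fun {a} {b} ha hb => inN_mul a b ha hb
  one_mem' := by decide
  inv_mem' := fun {a} ha => inN_inv a ha

/-- `|N| = 12`. [folklore] -/
private theorem natCard_N : Nat.card N = 12 := by
  have h : Nat.card N = Nat.card {g : SL(2, ZMod 5) // inN g = true} := rfl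
  rw [h, Nat.card_eq_fintype_card, Fintype.card_subtype]
  decide +kernel

/-- The Gaussian-integer values of `θ` on `N = [aʲ] ++ [aʲx]`: `aʲ ↦ (−1)ʲ`, `aʲx ↦ (−1)ʲ i`
(and `1` off `N`). [cite: Booker2006, §2 pp. 390–391] -/
def thZ (g : SL(2, ZMod 5)) : GaussianInt :=
  if g = m 1 0 0 1 then 1 else
  if g = m 0 1 4 1 then -1 else
  if g = m 4 1 4 0 then 1 else
  if g = m 4 0 0 4 then -1 else
  if g = m 0 4 1 4 then 1 else
  if g = m 1 4 1 0 then -1 else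
  if g = m 0 2 2 0 then ⟨0, 1⟩ else
  if g = m 2 0 2 3 then ⟨0, -1⟩ else
  if g = m 2 3 0 3 then ⟨0, 1⟩ else
  if g = m 0 3 3 0 then ⟨0, -1⟩ else
  if g = m 3 0 3 2 then ⟨0, 1⟩ else
  if g = m 3 2 0 2 then ⟨0, -1⟩ else
  1

/-- The inverse values of `θ`. [folklore] -/
def thZi (g : SL(2, ZMod 5)) : GaussianInt :=
  if g = m 1 0 0 1 then 1 else
  if g = m 0 1 4 1 then -1 else
  if g = m 4 1 4 0 then 1 else
  if g = m 4 0 0 4 then -1 else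
  if g = m 0 4 1 4 then 1 else
  if g = m 1 4 1 0 then -1 else
  if g = m 0 2 2 0 then ⟨0, -1⟩ else
  if g = m 2 0 2 3 then ⟨0, 1⟩ else
  if g = m 2 3 0 3 then ⟨0, -1⟩ else
  if g = m 0 3 3 0 then ⟨0, 1⟩ else
  if g = m 3 0 3 2 then ⟨0, -1⟩ else
  if g = m 3 2 0 2 then ⟨0, 1⟩ else
  1

/-- `θ · θ⁻¹ = 1` pointwise (kernel check). [folklore] -/
private theorem thZ_mul_thZi : ∀ g : SL(2, ZMod 5), thZ g * thZi g = 1 := by decide +kernel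
/-- `θ⁻¹ · θ = 1` pointwise (kernel check). [folklore] -/
private theorem thZi_mul_thZ : ∀ g : SL(2, ZMod 5), thZi g * thZ g = 1 := by decide +kernel
/-- `θ(1) = 1`. [folklore] -/
private theorem thZ_one : thZ 1 = 1 := by decide
/-- `θ` is multiplicative on `N` (kernel check). [folklore] -/
private theorem thZ_mul : ∀ a b : SL(2, ZMod 5), inN a = true → inN b = true →
    thZ (a * b) = thZ a * thZ b := by decide +kernel

/-- `θ` as a homomorphism `N → ℤ[i]ˣ`. [cite: Booker2006, §2 pp. 390–391] -/
def thU : N →* GaussianIntˣ where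
  toFun h := ⟨thZ h, thZi h, thZ_mul_thZi h, thZi_mul_thZ h⟩
  map_one' := Units.ext thZ_one
  map_mul' := fun a b => Units.ext (thZ_mul a b a.2 b.2)

/-- `θ : N → ℂˣ`, a linear character of order `4`. [cite: Booker2006, §2 pp. 390–391] -/
def th : N →* ℂˣ := (Units.map GaussianInt.toComplex.toMonoidHom).comp thU

/-- Values of `θ` in `ℂ`. [folklore] -/
private theorem coe_th (h : N) : ((th h : ℂˣ) : ℂ) = GaussianInt.toComplex (thZ h) := rfl

/-- The block test for `Ind_N θ = χ₄ + χ₆`. [folklore] -/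
def test10 (s : SL(2, ZMod 5)) : Bool := decide (indSum inN thZ s = ⟨12 * (T4 s + T6 s), 0⟩)

/-- Block `0` of the kernel check of `test10`. [folklore] -/
private theorem test10_b0 : ((elems.drop 0).take 24).all test10 = true := by decide +kernel
/-- Block `1` of the kernel check of `test10`. [folklore] -/
private theorem test10_b1 : ((elems.drop 24).take 24).all test10 = true := by decide +kernel
/-- Block `2` of the kernel check of `test10`. [folklore] -/
private theorem test10_b2 : ((elems.drop 48).take 24).all test10 = true := by decide +kernel
/-- Block `3` of the kernel check of `test10`. [folklore] -/
private theorem test10_b3 : ((elems.drop 72).take 24).all test10 = true := by decide +kernel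
/-- Block `4` of the kernel check of `test10`. [folklore] -/
private theorem test10_b4 : ((elems.drop 96).take 24).all test10 = true := by decide +kernel

/-- **The table of `Ind_N θ`** (kernel computation): `Σ_t [t⁻¹st ∈ N] θ(t⁻¹st) = 12·(χ₄ + χ₆)(s)`.
[cite: Booker2006, §2 pp. 390–391] -/
theorem indSum_N_th (s : SL(2, ZMod 5)) : indSum inN thZ s = ⟨12 * (T4 s + T6 s), 0⟩ :=
  of_decide_eq_true (forall_of_blocks test10 test10_b0 test10_b1 test10_b2 test10_b3 test10_b4 s)

/-- **`Ind_N^{SL(2,5)} θ = χ₄ + χ₆`.** [cite: Booker2006, §2 pp. 390–391] -/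
theorem indClassFun_N_th_eq : indClassFun N (fun h => ((th h : ℂˣ) : ℂ)) = chi4 + chi6 := by
  funext s
  rw [indClassFun_eq_of_units N inN (fun _ => Iff.rfl) thZ th coe_th s, indSum_N_th, natCard_N,
    GaussianInt.toComplex_def', Pi.add_apply, chi4, chi6]
  push_cast; ring

/-- **`χ₄` is a virtual character** (`= Ind_N θ − Ind_B ψ`). [cite: Booker2006, §2 pp. 390–391] -/
theorem chi4_mem_virtChars : chi4 ∈ virtChars SL(2, ZMod 5) := by
  have h : chi4 = indClassFun N (fun h => ((th h : ℂˣ) : ℂ)) - chi6 := by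
    rw [indClassFun_N_th_eq]; abel
  rw [h]
  exact (virtChars SL(2, ZMod 5)).sub_mem
    (((isCharacter_coe_monoidHom' th).indClassFun N).mem_virtChars) isCharacter_chi6.mem_virtChars

/-- **`χ₄` is an irreducible character of `SL(2,5)`** (the faithful one of degree `4`: a virtual
character of norm `1` and degree `4 > 0`). [cite: Booker2006, §2 pp. 390–391] -/
theorem isIrrChar_chi4 : IsIrrChar SL(2, ZMod 5) chi4 :=
  isIrrChar_of_mem_virtChars_of_classInner_eq_one chi4_mem_virtChars classInner_chi4 chi4_one
    (by norm_num)

/-- `χ₁` is a virtual character. [cite: Booker2006, §2 p. 391] -/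
theorem chi1_mem_virtChars : chi1 ∈ virtChars SL(2, ZMod 5) := by
  rw [chi1_eq]
  exact (virtChars SL(2, ZMod 5)).sub_mem isCharacter_chi6.mem_virtChars isIrrChar_chi4.mem_virtChars

end SL25

end Booker2006

end Literature.NumberTheory.LFunctions

end
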